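import Mathlib
import Summits.MatrixMultiplication.MatrixMultiplication.Theses.FourierTwoFamiliesModP
import Summits.MatrixMultiplication.MatrixMultiplication.Theorems.PrimeTwoFamilies.Negative.Slices
import Summits.MatrixMultiplication.MatrixMultiplication.Theorems.FourierTwoFamiliesModPCyclicReductionTransfer
import Summits.MatrixMultiplication.MatrixMultiplication.Theorems.FourierTwoFamiliesModPPrimeTwoFamiliesLadderConverse
import Summits.MatrixMultiplication.MatrixMultiplication.Theorems.FourierTwoFamiliesModPPrimeTwoFamiliesStubCapBookkeeping
import Summits.MatrixMultiplication.MatrixMultiplication.Theorems.FourierTwoFamiliesModPPrimeTwoFamiliesStubHonestOfSelfConverse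
import Summits.MatrixMultiplication.MatrixMultiplication.Theorems.FourierTwoFamiliesModPPrimeTwoFamiliesStubGadgetsOfCrux
import Literature.Computability.AlgebraicComplexity.SimultaneousDoubleProduct

/-!
# `PrimeTwoFamilies ↔` apex SDPP families in arbitrary cyclic groups; self-converse gadgets (support file)

Item `stmt-MatrixMultiplication-14308` (`FourierTwoFamiliesModP.PrimeTwoFamilies`, CKSU 2005 Conj. 4.7 with prime
cyclic hosts), line `Sketch`.

An HONEST CYCLIC FAMILY of slice `ε` in `ℤ/m` is an SDPP family — clauses (W), (X) of the route verbatim — of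
`n ≥ m^{1/2-ε}` pairs of co-volume `|A i||B i| ≥ m^{1-ε}`, in an ARBITRARY cyclic group `ℤ/m` (no primality,
no host-size clause; `(1/2, 1)` is the apex of the packing bound `n · √(min co-volume) ≤ m`).  A SELF-CONVERSE
GADGET of slice `ε` in `ℤ/m` is a list of `r ≥ m^{1-ε}` direct pairs `(P c, Q c)_{c<r}` (letters may
coincide) of co-volume `≥ m^{1-ε}` with a map `π : Fin r → Fin r` under which every ordered pair of distinct
letters is strongly separated (cross differences `q - p`, `p ∈ P σ`, `q ∈ Q τ`, avoid all diagonal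
differences `q' - p'`, `p' ∈ P c`, `q' ∈ Q c`) either directly or after `π`.

* `primeTwoFamiliesAt_of_honestCyclic`, `honestCyclic_iff_primeTwoFamilies` (NEW as standalone statements):
  honest cyclic families for every `ε > 0` and arbitrarily large `m` `↔` the crux.  (⇒) the tree's carry-free
  transfer with ONE cyclic factor (`Theorems.exists_prime_sdpp_of_addEquiv`, `k = 1`,
  `ZMod m ≃+ (Fin 1 → ZMod m)`, Bertrand prime `p ≤ 6m`, sizes kept) and the landed exponent bookkeeping
  at word length `L = 1` (`CapacityLift.stub_capBookkeeping`): no lift, no code, no tensor power — the only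
  exponent slack absorbed is the Bertrand factor `6`; (⇐) a slice-`min ε 1` witness in `ℤ/p` is such a
  family (`LadderLift.ladder_exponents`).  Use: any apex construction in a COMPOSITE cyclic group (e.g. a CRT
  product `ℤ/m₁m₂`) closes the crux through this lemma in one line.
* `selfConverseGadgets_iff_primeTwoFamilies` — the ledger-registered helper signature of this name
  (crux stmt-MatrixMultiplication-14308, registered 2026-08-16T11:10Z; FIRST landed as
  `CapacityLift.selfConverseGadgets_iff_primeTwoFamilies` through graph-word codes and the code lift), here
  the one-line corollary: (⇒) a gadget CONTAINS an honest cyclic family in the same `ℤ/m` — the `π`-images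
  of the `≥ m^{1/2-ε}` letters through a popular point (`CapacityLift.stub_honestOfSelfConverse`) — then
  `honestCyclic_iff_primeTwoFamilies`; (⇐) letter repetition (`CapacityLift.stub_gadgetsOfCrux`).  (Siege
  best-of-24, attempt k17, variation "Mathlib API route": everything is composed from landed tree theorems;
  no new definitions — both notions are inlined in every signature.)
-/

-- single-conjunct summit: the mandated namespace repeats `MatrixMultiplication` (summit = sub-problem).
set_option linter.dupNamespace false

namespace Summit.MatrixMultiplication.MatrixMultiplication.Theorems.PrimeTwoFamilies.HonestCyclic

open Finset
open Summit.MatrixMultiplication.MatrixMultiplication.Theses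
open Summit.MatrixMultiplication.MatrixMultiplication.Theorems.PrimeTwoFamilies.Negative
open Literature.Computability.AlgebraicComplexity

/-- **Honest cyclic families give the crux, slice by slice, with a single-factor transfer.**  If for every
`ε > 0` there are arbitrarily large `m` and SDPP families ((W) ∧ (X)) in `ZMod m` with `m^{1/2-ε} ≤ n` pairs
of co-volume `m^{1-ε} ≤ |A i||B i|`, then every slice `0 < δ ≤ 1` of `PrimeTwoFamilies` holds: choose `ε`
and `m₀` by `CapacityLift.stub_capBookkeeping` (used at word length `L = 1`), take a level `m ≥ max m₀ 1`,
move the family into a Bertrand prime `p ≤ 2·3·m` by `exists_prime_sdpp_of_addEquiv` with ONE cyclic factor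
(`(AddEquiv.piUnique _).symm : ZMod m ≃+ (Fin 1 → ZMod m)`; sizes are kept), and keep the first `n` pairs
(`Fin.castLE`), `n₀ ≤ n ≤ N`, `p ≤ n^{2+δ}`, `n^{2-δ} ≤ m^{1-ε} ≤` co-volume. -/
theorem primeTwoFamiliesAt_of_honestCyclic
    (hH : ∀ ε : ℝ, 0 < ε → ∀ m₀ : ℕ, ∃ m ≥ m₀, ∃ n : ℕ, ∃ A B : Fin n → Finset (ZMod m),
      (∀ i : Fin n, ∀ a ∈ A i, ∀ a' ∈ A i, ∀ b ∈ B i, ∀ b' ∈ B i,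
          (a - a') + (b - b') = 0 → a = a' ∧ b = b') ∧
      (∀ i j k : Fin n, ∀ a ∈ A i, ∀ a' ∈ A j, ∀ b ∈ B j, ∀ b' ∈ B k,
          (a - a') + (b - b') = 0 → i = k) ∧
      (m : ℝ) ^ (1 / 2 - ε) ≤ (n : ℝ) ∧
      ∀ i : Fin n, (m : ℝ) ^ (1 - ε) ≤ (((A i).card * (B i).card : ℕ) : ℝ))
    {δ : ℝ} (hδ : 0 < δ) (hδ1 : δ ≤ 1) : PrimeTwoFamiliesAt δ := by
  classical
  intro n₀
  obtain ⟨ε, hε, hbook⟩ := CapacityLift.stub_capBookkeeping δ hδ hδ1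
  obtain ⟨m₀, hm₀⟩ := hbook n₀
  obtain ⟨m, hm, N, A, B, hW, hX, hN, hcov⟩ := hH ε hε (max m₀ 1)
  have hm₀m : m₀ ≤ m := le_trans (le_max_left _ _) hm
  have hm1 : 1 ≤ m := le_trans (le_max_right _ _) hm
  -- transfer into a prime cyclic host with ONE cyclic factor: `p ≤ 2 · (3 · m)`
  obtain ⟨p, hp, hpR, A', B', hcard, hW', hX'⟩ :=
    exists_prime_sdpp_of_addEquiv hW hX (m := fun _ : Fin 1 => m) (fun _ => hm1)
      (AddEquiv.piUnique (fun _ : Fin 1 => ZMod m)).symm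
  rw [Fin.prod_const] at hpR
  -- the bookkeeping at word length `L = 1`
  have hN' : ((m : ℝ) ^ ((1 : ℕ) : ℝ)) ^ (1 / 2 - ε) ≤ (N : ℝ) := by
    rwa [Nat.cast_one, Real.rpow_one]
  obtain ⟨n, hn₀, hnN, hpn, hnP⟩ := hm₀ m hm₀m 1 le_rfl N hN' p hpR
  rw [pow_one] at hnP
  refine ⟨n, hn₀, p, hp, A' ∘ Fin.castLE hnN, B' ∘ Fin.castLE hnN, ?_, ?_, hpn, ?_⟩
  · intro i
    exact hW' (Fin.castLE hnN i)
  · intro i j k a ha a' ha' b hb b' hb' h0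
    exact Fin.castLE_injective hnN (hX' _ _ _ a ha a' ha' b hb b' hb' h0)
  · intro i
    have hci := hcard (Fin.castLE hnN i)
    simp only [Function.comp_apply]
    rw [hci.1, hci.2]
    exact hnP.trans (hcov _)

/-- **Honest cyclic families `↔ PrimeTwoFamilies`** (the modulus-free apex normal form of the crux).  CKSU
Conj. 4.7 with prime cyclic hosts holds iff for every `ε > 0` there are arbitrarily large moduli `m` (not
necessarily prime) and SDPP families in `ZMod m` with `m^{1/2-ε} ≤ n` pairs of co-volume
`m^{1-ε} ≤ |A i||B i|`.  (⇒ of the displayed `↔`) `primeTwoFamiliesAt_of_honestCyclic` for `δ ≤ 1` and slice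
monotonicity above `1`; (⇐) an SDPP witness `(A i, B i)_{i<n}` in `ℤ/p` of the slice `δ = min ε 1`
(`p ≤ n^{2+δ}`, `n^{2-δ} ≤ |A i||B i|`) is an honest cyclic family of slice `ε` in `ZMod p`:
`p^{1/2-ε} ≤ n`, `p^{1-ε} ≤ n^{2-δ}` (`LadderLift.ladder_exponents`) and `p ≥ |A i||B i| ≥ n ≥ m₀`
(`card_mul_card_le_of_dpp`).  The registered helper `selfConverseGadgets_iff_primeTwoFamilies` below is its
one-line corollary through `CapacityLift.stub_honestOfSelfConverse`. -/
theorem honestCyclic_iff_primeTwoFamilies :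
    (∀ ε : ℝ, 0 < ε → ∀ m₀ : ℕ, ∃ m ≥ m₀, ∃ n : ℕ, ∃ A B : Fin n → Finset (ZMod m),
      (∀ i : Fin n, ∀ a ∈ A i, ∀ a' ∈ A i, ∀ b ∈ B i, ∀ b' ∈ B i,
          (a - a') + (b - b') = 0 → a = a' ∧ b = b') ∧
      (∀ i j k : Fin n, ∀ a ∈ A i, ∀ a' ∈ A j, ∀ b ∈ B j, ∀ b' ∈ B k,
          (a - a') + (b - b') = 0 → i = k) ∧
      (m : ℝ) ^ (1 / 2 - ε) ≤ (n : ℝ) ∧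
      ∀ i : Fin n, (m : ℝ) ^ (1 - ε) ≤ (((A i).card * (B i).card : ℕ) : ℝ)) ↔
    FourierTwoFamiliesModP.PrimeTwoFamilies := by
  refine ⟨fun hH => ?_, fun hT => ?_⟩
  · rw [primeTwoFamilies_iff]
    intro δ hδ
    by_cases h1 : δ ≤ 1
    · exact primeTwoFamiliesAt_of_honestCyclic hH hδ h1
    · exact (primeTwoFamiliesAt_of_honestCyclic hH one_pos le_rfl).mono (le_of_not_ge h1)
  · intro ε hε m₀
    set δ : ℝ := min ε 1
    have hδ : 0 < δ := lt_min hε one_pos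
    have hδε : δ ≤ ε := min_le_left _ _
    have hδ1 : δ ≤ 1 := min_le_right _ _
    obtain ⟨n, hn, p, hp, A, B, hW, hX, hpn, hAB⟩ := hT δ hδ (m₀ + 2)
    haveI : Fact p.Prime := ⟨hp⟩
    have hn1 : 1 ≤ n := by omega
    have hn1' : (1 : ℝ) ≤ n := by exact_mod_cast hn1
    -- `m₀ ≤ p`: `m₀ + 2 ≤ n ≤ n^{2-δ} ≤ |A i₀||B i₀| ≤ p`
    have i₀ : Fin n := ⟨0, by omega⟩
    have hABp : (A i₀).card * (B i₀).card ≤ p := by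
      have := card_mul_card_le_of_dpp (H := ZMod p) (hW i₀)
      rwa [ZMod.card] at this
    have hm₀ : m₀ ≤ p := by
      have h1 : (n : ℝ) ≤ (n : ℝ) ^ (2 - δ) := by
        calc (n : ℝ) = (n : ℝ) ^ (1 : ℝ) := (Real.rpow_one _).symm
          _ ≤ (n : ℝ) ^ (2 - δ) := Real.rpow_le_rpow_of_exponent_le hn1' (by linarith)
      have h2 : (n : ℝ) ≤ (p : ℝ) := (h1.trans (hAB i₀)).trans (by exact_mod_cast hABp)
      have h3 : n ≤ p := by exact_mod_cast h2
      omega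
    obtain ⟨hr, hcov⟩ := LadderLift.ladder_exponents hδ hδε hδ1 hp.one_lt.le hn1 hpn
    exact ⟨p, hm₀, n, A, B, hW, hX, hr, fun i => hcov.trans (hAB i)⟩

/-- **Self-converse gadgets `↔ PrimeTwoFamilies`** (ledger-registered helper signature
`selfConverseGadgets_iff_primeTwoFamilies` of crux stmt-MatrixMultiplication-14308, verbatim; first landed as
`CapacityLift.selfConverseGadgets_iff_primeTwoFamilies` by the code route — this is the lift-free proof).
For every `ε > 0` and `m₀` there are `m ≥ m₀`, direct pairs `(P c, Q c)_{c<r}` in `ZMod m` and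
`π : Fin r → Fin r` with every ordered pair of distinct letters strongly separated directly or after `π`,
`m^{1-ε} ≤ r` and `m^{1-ε} ≤ |P c||Q c|` — IFF CKSU Conj. 4.7 holds with prime cyclic hosts.  (⇒) the
`π`-images of the letters through a popular point are an honest cyclic family of slice `ε` in the same
`ZMod m` (`CapacityLift.stub_honestOfSelfConverse`), and honest cyclic families give the crux
(`honestCyclic_iff_primeTwoFamilies`); (⇐) letter repetition (`CapacityLift.stub_gadgetsOfCrux`). -/
theorem selfConverseGadgets_iff_primeTwoFamilies :
    (∀ ε : ℝ, 0 < ε → ∀ m₀ : ℕ, ∃ m ≥ m₀, ∃ r : ℕ, ∃ P Q : Fin r → Finset (ZMod m),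
      ∃ π : Fin r → Fin r,
      (∀ c : Fin r, ∀ x ∈ P c, ∀ x' ∈ P c, ∀ y ∈ Q c, ∀ y' ∈ Q c,
          (x - x') + (y - y') = 0 → x = x' ∧ y = y') ∧
      (∀ σ τ : Fin r, σ ≠ τ →
        (∀ p ∈ P σ, ∀ q ∈ Q τ, ∀ c : Fin r, ∀ p' ∈ P c, ∀ q' ∈ Q c, q - p ≠ q' - p') ∨
        (∀ p ∈ P (π σ), ∀ q ∈ Q (π τ), ∀ c : Fin r, ∀ p' ∈ P c, ∀ q' ∈ Q c, q - p ≠ q' - p')) ∧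
      (m : ℝ) ^ (1 - ε) ≤ (r : ℝ) ∧
      ∀ c : Fin r, (m : ℝ) ^ (1 - ε) ≤ (((P c).card * (Q c).card : ℕ) : ℝ)) ↔
    FourierTwoFamiliesModP.PrimeTwoFamilies :=
  ⟨fun h => honestCyclic_iff_primeTwoFamilies.1 (CapacityLift.stub_honestOfSelfConverse h),
   fun hT => CapacityLift.stub_gadgetsOfCrux hT⟩

end Summit.MatrixMultiplication.MatrixMultiplication.Theorems.PrimeTwoFamilies.HonestCyclic
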